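import Mathlib
import Literature.MathematicalPhysics.QuantumFieldTheory.Balaban1983to89.B4Sect5Torus
import Literature.MathematicalPhysics.QuantumFieldTheory.Balaban1983to89.B6FrameReduction

/-!
# `Balaban1983to89.B6Sect5Torus` — (S5) of B6 on the torus T^{(k)}: the torus FRAME, its ENGINE (the theorem of
[3] on tori, proved), and the (S5) reduction scheme with ONE pair of constants for ℤ^d and all tori at once

B6 = T. Bałaban, *Propagators and renormalization transformations for lattice gauge theories. II*, Commun. Math.
Phys. **96**, 223–250 (1984) [Balaban1984PropagatorsII]; [3] = B4 = T. Bałaban, *Regularity and decay of lattice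
Green's functions*, Commun. Math. Phys. **89** (1983) 571–597 [Balaban1983RegularityDecay], Sect. 5 Theorem p. 594.
Quotations read from the ×2 page renders `run/shared/lean/pub/pub-balaban/b2b-balaban-ref1/pages/
1984-cmp96-propagators-rt-II/…-p027-x2.png` (p. 249) and `…-p028-x2.png` (p. 250) (journal page = PDF page + 222),
not from an OCR layer.

CITATION HEADER (lean-in-tree rule 2026-08-18).  Cell `pub-balaban`, unit `b2b-balaban-pv09-g4` (surge node prover
#09, gen 4; journal claim G-pv09g4-1-KERNEL = B6-S5-TORUS-WRAPPER; the item is also GAPS G-b06g4-1 of unit b06-g4,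
marked there as owned by this claim).  This module is the PLUG announced in both siblings it imports:
`…B4Sect5Torus` (this unit, node 1: the Sect. 5 Theorem of [3] proved over an abstract index set with a pseudo-distance
and a uniform summability profile, and instantiated on the tori — `torusEngine_holds`) and `…B6FrameReduction` (unit
b06-g4: the reduction scheme of B6's use sites over an arbitrary FRAME, with the theorem of [3] as an ENGINE HYPOTHESIS
on a class of frames — its header: *"for the torus frames the engine is the torus form of [3], which is NOT proved in
this file … it plugs into `reductions_uniform` below by `Engine`'s definition, nothing else being needed"*).  Nothing
landed is edited or restated; the two vocabularies are joined by `Iff.rfl` dictionary lemmas.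

## What is printed (verbatim)

* B6 p. 249, before (2.153) [the display is printed with the label "(1.152)", sic — cell DIVERGENCE D-b06.9]: *"Doing
  a k+1 renormalization transformation we have to calculate an integral of the form const∫dBδ(QB)δ_{Ax}(B)
  e^{−½⟨B,Δ_kB⟩}F(B) (2.152) on the whole lattice T^{(k)}, or on a subset Λ ⊂ T^{(k)}."*
* B6 p. 250, after (2.157): *"C is a short-ranged operator, so C*Δ_kC has the same exponential decay as Δ_k. Now we
  may apply the theory developed in Sect. 5 of [3] on unit lattice operators. It gives us an exponential decay, and all
  the other properties, for the operator (C*Δ_kC)⁻¹, hence for C^{(k)}_Λ also. Such a scheme will be applied in the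
  future to investigate all unit lattice propagators defined by generalizations of the integrals (2.152), (2.154)."*
* [3] p. 594, the Sect. 5 Theorem, is printed for finite Ω ⊂ Z^d with |x − x′| the distance of Z^d (`B4.Hyp56`,
  `B4.Sect5ThmUniform`); T^{(k)} is a torus (B5 (3): T_η = periodic lattice) — cell census G-pv09g2-1 (vi).

## Kernel-checked here (no `sorry`; axioms ⊆ {propext, Classical.choice, Quot.sound})

§1 `torus d P : Frame` — the torus ∏_μ ℤ/P_μℤ (`B4Sect5Torus.TSite d P`) with the periodic sup-distance
`B4Sect5Torus.tdist P` IS a frame in the sense of `B6FrameReduction.Frame` (no hypothesis on P: a site of the torus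
witnesses P_μ ≥ 1); `torusClass d` = the class of all torus frames of dimension d, every finite region Ω allowed — in
particular Ω = the whole torus (`Finset.univ`, (2.152) *"on the whole lattice T^{(k)}"*), which has no counterpart
among the finite Ω ⊂ ℤ^d; dictionary `hyp56_torus_iff` / `invDecay_torus_iff` (`Iff.rfl` with
`B4Sect5Torus.TorusHyp56` / the conclusion of `B4Sect5Torus.TorusEngine`).
§2 (v1.1: REMOVED — see the note below) the engine-from-a-uniform-profile fact lives in `…B6FrameReduction` §5
(v1.1 of that module, unit b06-g4: `Frame.idxρ`, `hyp56_iff_abstract`, `profileClass`, `engine_of_profile`,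
`engine_of_profileBound` — the input isolated by the cell's cross-read GAPS G-A19-1, unit adv1-g14: an engine on a
class of frames is NOT implied by the frame axioms; the missing input is a UNIFORM SUMMABILITY PROFILE
Σ_{x′} e^{−aρ(x,x′)} ≤ K(a)); it is used here BY NAME.
§3 `engine_torus` — the ENGINE ON THE TORUS CLASS HOLDS (from `B4Sect5Torus.torusEngine_holds`; equivalently
`engine_torus_of_profile`, from `B6FrameReduction.engine_of_profileBound` with K(a) = N·K_d(a),
`B4Sect5Torus.trho_sumBound`); `engine_zd_or_torus` — ONE engine, i.e. one pair (c₁, δ₁), for the class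
{ℤ^d} ∪ {all d-dimensional tori} (both have the profile N·K_d(a): `B4Sect5Torus.zrho_sumBound`, `trho_sumBound`) — the kernel form of *"independent of j and Λ"* (p. 242) across (S2)/(S3) on ℤ^d and (S5) on T^{(k)}.
§4 `reductions_torus` — the (S5) assertion on the tori: ONE c and ONE δ such that every reduction
(`B6FrameReduction.Reduction (torus d P) N N′`: Ω, Ω′ ⊂ T, Δ, C with the printed-shape inputs `Reduction.Printed`)
over EVERY torus has |C(C*Δ_kC)⁻¹C*(x,x′)| ≤ c·e^{−δ·tdist(x,x′)} — `B6FrameReduction.reductions_uniform` fed with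
`engine_torus`; `reductions_zd_or_torus` — the same with one (c, δ) serving ℤ^d and all tori simultaneously.

## Typing remarks / scope

(i) What is NOT done here: the torus counterpart of the explicit bond-elimination matrix C of p. 250 (constructed over
ℤ^d in `…B6BondElimination`, unit b06-g3 — blocks and pivots typed in ℤ^d; on T^{(k)} the blocks B(y) do not wrap for
L | period, but that construction is not re-indexed here): as in `B6FrameReduction`, C enters through
`Reduction.Printed` (range, ℓ¹ bounds, ‖CB′‖ ≥ ‖B′‖, the lower bound (2.153)/(2.157) on its range) — cell census
G-pv09g4-2.  (ii) *"all the other properties"* ((5.8), (5.10) of [3]) hold on the torus too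
(`B4Sect5Torus.torusSect5ThmUniform_holds`) but only (5.7) at Λ = Ω is consumed by the scheme, as in
`B6FrameReduction` (its remark (iii)).  (iii) The torus distance is `tdist` = max_μ dist(x_μ − x′_μ, P_μℤ) counted on
representatives (`B4Sect5Torus` §8); for the (S5) torus T^{(k)} = T^{(k)}_1 of B5 (3)–(4) all P_μ are equal, which is a
special case.  Value = kernel certificate closing the located gap G-pv09g4-1 / G-b06g4-1 (the (S5) sentence of p. 250
now type-checks on the carrier it is printed for, with [3] discharged), NOT summit progress.

v1.1 (same unit, minutes after v1): v1's §2 (`idxρ`, `idxρ_isPseudoDist`, `hyp56_frame_iff`, `engine_of_profile`)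
duplicated, under other names, §5 of `…B6FrameReduction` v1.1 — which had landed two minutes before v1 of this file
was checked (a journal race, cell census C-pv09g4-2); v1.1 deletes the four duplicates (nothing imported them) and
derives §3 from `B6FrameReduction.engine_of_profileBound`.  No statement of §§1, 3, 4 changed.
-/

open Finset Matrix

namespace Literature.MathematicalPhysics.QuantumFieldTheory.Balaban1983to89.B6Sect5Torus

open B6FrameReduction (Frame Engine Reduction)
open B4Sect5Torus (TSite TIdx tdist)

/-! ## §1  The torus frame, the torus class, and the dictionary with `B4Sect5Torus` -/

section TorusFrame

variable (d : ℕ)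

/-- A site of the torus ∏_μ ℤ/P_μℤ witnesses that every period is ≥ 1 (its μ-th coordinate lives in `Fin (P μ)`).
[folklore] -/
theorem periods_pos {d : ℕ} {P : Fin d → ℕ} (x : TSite d P) : ∀ i, 1 ≤ P i :=
  fun i => (x i).pos

/-- The TORUS FRAME T_P = ∏_μ ℤ/P_μℤ with the periodic sup-distance `tdist P` (B5 (3): *"T_η = {x ∈ ηZ^d : −L_μ ≤ x_μ <
L_μ, μ = 1, …, d}"*, distances *"in the sense of a periodic distance on the torus"* B12 (1.9)) — an instance of
`B6FrameReduction.Frame` (site type, decidable equality, ρ(x,x) = 0, symmetry, triangle inequality: `B4Sect5Torus.tdist_self`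
/ `tdist_symm` / `tdist_triangle`).  No hypothesis on P is needed: the axioms quantify over sites, and a site exists only
if all P_μ ≥ 1 (`periods_pos`). [cite: Balaban1984PropagatorsII, (2.152) p.249] -/
noncomputable def torus (P : Fin d → ℕ) : Frame where
  S := TSite d P
  ρ := tdist P
  ρ_self := B4Sect5Torus.tdist_self P
  ρ_comm := fun x y => B4Sect5Torus.tdist_symm (periods_pos x) x y
  ρ_triangle := fun x y z => B4Sect5Torus.tdist_triangle (periods_pos x) x y z

/-- The pseudo-metric of the torus frame is `tdist` (definitionally). [folklore] -/
theorem torus_ρ (P : Fin d → ℕ) (x y : TSite d P) : (torus d P).ρ x y = tdist P x y := rfl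

/-- The sites of the torus frame are `TSite d P` (definitionally). [folklore] -/
theorem torus_S (P : Fin d → ℕ) : (torus d P).S = TSite d P := rfl

/-- The CLASS OF TORUS FRAMES of dimension d: all period vectors P, EVERY finite region Ω ⊂ T_P allowed — in particular
Ω = the whole torus, (2.152) *"on the whole lattice T^{(k)}, or on a subset Λ ⊂ T^{(k)}"*. [cite: Balaban1984PropagatorsII, (2.152) p.249] -/
def torusClass : (F : Frame) → Finset F.S → Prop := fun F _ => ∃ P : Fin d → ℕ, F = torus d P

/-- The whole torus is a legitimate (finite) region of the torus frame. [folklore] -/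
theorem univ_mem_torusClass (P : Fin d → ℕ) : torusClass d (torus d P) (Finset.univ : Finset (TSite d P)) :=
  ⟨P, rfl⟩

variable {d} {N : ℕ} {P : Fin d → ℕ}

/-- DICTIONARY: (5.6) over the torus frame IS `B4Sect5Torus.TorusHyp56` (definitionally). [folklore] -/
theorem hyp56_torus_iff (Ω : Finset (TSite d P)) (A : Matrix (TIdx P Ω N) (TIdx P Ω N) ℝ) (γ₀ c₀ δ₀ : ℝ) :
    B6FrameReduction.Hyp56 (torus d P) Ω A γ₀ c₀ δ₀ ↔ B4Sect5Torus.TorusHyp56 Ω A γ₀ c₀ δ₀ := Iff.rfl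

/-- DICTIONARY: (5.7) at Λ = Ω over the torus frame IS the conclusion of `B4Sect5Torus.TorusEngine`
(definitionally). [folklore] -/
theorem invDecay_torus_iff (Ω : Finset (TSite d P)) (A : Matrix (TIdx P Ω N) (TIdx P Ω N) ℝ) (c₁ δ₁ : ℝ) :
    B6FrameReduction.InvDecay (torus d P) Ω A c₁ δ₁ ↔
      ∀ p q : TIdx P Ω N, |A⁻¹ p q| ≤ c₁ * Real.exp (-(δ₁ * tdist P p.1.1 q.1.1)) := Iff.rfl

end TorusFrame

/-! ## §3  The engine on the torus class HOLDS; one engine for ℤ^d and all tori -/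

section Engines

variable (d M : ℕ)

/-- KERNEL-CHECKED — THE ENGINE ON THE TORUS CLASS: for all positive (γ₀, c₀, δ₀) there are positive (c₁, δ₁) such
that for EVERY torus T_P (every period vector P), every region Ω ⊂ T_P (the whole torus included) and every A on
L²(Ω; ℝ^M) with (5.6) in the torus distance, |A⁻¹(x,x′)| ≤ c₁e^{−δ₁·tdist(x,x′)} — `B4Sect5Torus.torusEngine_holds`
read through the dictionary of §1; this discharges the engine hypothesis of `B6FrameReduction.reductions_uniform`
for the tori of (2.152). [cite: Balaban1983RegularityDecay, Sect. 5 Theorem p.594 + p.597] -/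
theorem engine_torus : Engine M (torusClass d) := by
  intro γ₀ c₀ δ₀ hγ hc hδ
  obtain ⟨c₁, δ₁, hc₁, hδ₁, H⟩ := B4Sect5Torus.torusEngine_holds d M γ₀ c₀ δ₀ hγ hc hδ
  refine ⟨c₁, δ₁, hc₁, hδ₁, ?_⟩
  rintro F Ω ⟨P, rfl⟩ A hA p q
  exact H P (periods_pos p.1.1) Ω A hA p q

/-- The same engine obtained from the uniform PROFILE K(a) = M·K_d(a) of the torus regions
(`B4Sect5Torus.trho_sumBound`) through `B6FrameReduction.engine_of_profileBound` (the torus class is a subclass of the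
profile class of M·K_d). [folklore] -/
theorem engine_torus_of_profile : Engine M (torusClass d) :=
  B6FrameReduction.engine_of_profileBound (K := fun a => (M : ℝ) * B4Sect5Proof.latticeConst d a)
    (B4Sect5Torus.profile_nonneg d M)
    (by
      rintro F Ω ⟨P, rfl⟩ a ha p
      exact B4Sect5Torus.trho_sumBound (periods_pos p.1.1) Ω M a ha p)

/-- The class {ℤ^d} ∪ {all d-dimensional tori}: the carriers of (S1)–(S4) (regions of ℤ^d, `B6FrameReduction.zdClass`)
and of (S5) (regions of tori) together. [folklore] -/
def zdOrTorusClass : (F : Frame) → Finset F.S → Prop :=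
  fun F Ω => B6FrameReduction.zdClass d F Ω ∨ torusClass d F Ω

/-- KERNEL-CHECKED — ONE ENGINE FOR ℤ^d AND ALL TORI: both carriers have the SAME profile K(a) = M·K_d(a)
(`B4Sect5Torus.zrho_sumBound` for ℤ^d = `B4Sect5Proof.idxSum_le`; `trho_sumBound` for the tori), so one profile yields one
pair (c₁, δ₁) serving every region of ℤ^d and every region of every torus — the kernel form of *"an
exponential decay independent of j and Λ"* (p. 242) uniformly across the use sites (S2)/(S3) (on ℤ^d) and (S5) (on
T^{(k)}); via `B6FrameReduction.engine_of_profileBound`. [cite: Balaban1984PropagatorsII, p.242 + p.250] -/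
theorem engine_zd_or_torus : Engine M (zdOrTorusClass d) :=
  B6FrameReduction.engine_of_profileBound (K := fun a => (M : ℝ) * B4Sect5Proof.latticeConst d a)
    (B4Sect5Torus.profile_nonneg d M)
    (by
      rintro F Ω (hF | ⟨P, rfl⟩) a ha p
      · dsimp only [B6FrameReduction.zdClass] at hF
        subst hF
        exact B4Sect5Torus.zrho_sumBound Ω M a ha p
      · exact B4Sect5Torus.trho_sumBound (periods_pos p.1.1) Ω M a ha p)

end Engines

/-! ## §4  (S5) on the torus: the reduction scheme with the engine discharged -/

section S5

variable (d N N' : ℕ)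

/-- KERNEL-CHECKED — (S5) ON THE TORI, [3] DISCHARGED: for all positive (γ, c₀, δ₀, r, m) there are ONE c > 0 and ONE
δ > 0 such that for EVERY torus T_P and EVERY reduction over it — regions Ω, Ω′ ⊂ T_P (Ω = T_P, (2.152) *"on the whole
lattice T^{(k)}"*, or *"a subset Λ ⊂ T^{(k)}"*), Δ = Δ_k on Ω × Fin N symmetric with |Δ(x,x′)| ≤ c₀e^{−δ₀tdist(x,x′)},
B = CB′ with C of range ≤ r, ℓ¹ row/column sums ≤ m, ‖CB′‖ ≥ ‖B′‖ and γ‖CB′‖² ≤ ⟨CB′, ΔCB′⟩ ((2.153)/(2.157)) — the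
covariance (2.156) C^{(k)}_Λ = C(C*Δ_kC)⁻¹C* satisfies |C^{(k)}_Λ(x,x′)| ≤ c·e^{−δ·tdist(x,x′)}: *"Now we may apply
the theory developed in Sect. 5 of [3] on unit lattice operators. It gives us an exponential decay … for the operator
(C*Δ_kC)⁻¹, hence for C^{(k)}_Λ also"* — `B6FrameReduction.reductions_uniform` with the PROVED engine `engine_torus`.
[cite: Balaban1984PropagatorsII, (2.152)–(2.157) pp.249–250] -/
theorem reductions_torus {γ c₀ δ₀ r mC : ℝ} (hγ : 0 < γ) (hc : 0 < c₀) (hδ : 0 < δ₀) (hm : 0 < mC) :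
    ∃ c δ : ℝ, 0 < c ∧ 0 < δ ∧ ∀ (P : Fin d → ℕ) (T : Reduction (torus d P) N N'), T.Printed γ c₀ δ₀ r mC →
      ∀ p q : TIdx P T.Ω N, |T.cov p q| ≤ c * Real.exp (-(δ * tdist P p.1.1 q.1.1)) := by
  obtain ⟨c, δ, hc0, hδ0, H⟩ :=
    B6FrameReduction.reductions_uniform (N := N) (engine_torus d N') hγ hc hδ hm
  exact ⟨c, δ, hc0, hδ0, fun P T hT p q => H (torus d P) T ⟨P, rfl⟩ hT p q⟩

/-- KERNEL-CHECKED — ONE (c, δ) FOR ℤ^d AND ALL TORI: the reduction scheme with the joint engine `engine_zd_or_torus`: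
the same c and δ bound the covariances of every reduction over ℤ^d ((S2), (S3); `B6FrameReduction.zd`) and of every
reduction over every torus ((S5)). [cite: Balaban1984PropagatorsII, p.242 + p.246 + p.250] -/
theorem reductions_zd_or_torus {γ c₀ δ₀ r mC : ℝ} (hγ : 0 < γ) (hc : 0 < c₀) (hδ : 0 < δ₀) (hm : 0 < mC) :
    ∃ c δ : ℝ, 0 < c ∧ 0 < δ ∧
      (∀ T : Reduction (B6FrameReduction.zd d) N N', T.Printed γ c₀ δ₀ r mC →
        ∀ p q : (B6FrameReduction.zd d).Idx T.Ω N,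
          |T.cov p q| ≤ c * Real.exp (-(δ * dist (α := Fin d → ℤ) p.1.1 q.1.1))) ∧
      (∀ (P : Fin d → ℕ) (T : Reduction (torus d P) N N'), T.Printed γ c₀ δ₀ r mC →
        ∀ p q : TIdx P T.Ω N, |T.cov p q| ≤ c * Real.exp (-(δ * tdist P p.1.1 q.1.1))) := by
  obtain ⟨c, δ, hc0, hδ0, H⟩ :=
    B6FrameReduction.reductions_uniform (N := N) (engine_zd_or_torus d N') hγ hc hδ hm
  exact ⟨c, δ, hc0, hδ0, fun T hT p q => H _ T (Or.inl rfl) hT p q,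
    fun P T hT p q => H (torus d P) T (Or.inr ⟨P, rfl⟩) hT p q⟩

end S5

end Literature.MathematicalPhysics.QuantumFieldTheory.Balaban1983to89.B6Sect5Torus
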